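import Summits.BirchSwinnertonDyer.BirchSwinnertonDyer.Theorems.ErratumRoadFiveNonSurjCornerTwinKatoEngine
import Literature.NumberTheory.EllipticCurves.IwasawaOrderOfVanishing
import HarnessLib

/-!
# Route `PrintX11a`, crux U3 `UpperNonSurjThree` (item stmt-BirchSwinnertonDyer-20613): the two rank-`0` leading-term lemmas of
# K2's Euler-half engine with `rank E(ℚ) = 0` and `#Ш[p^∞] < ∞` DERIVED from the divisibility (no Gross–Zagier–Kolyvagin)

Cell `bsd-print-x11a`, width seat bsd-line-x11a-p2 g3 (`--supports stmt-BirchSwinnertonDyer-20613 --as helper`). Theorems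
only; Theses-free; BSD is not proved by any of this; nothing is asserted about any curve. Lemma file for
`PrintX11aUpperNonSurjThreeEngineWithoutGZK.lean` (the engine and the U3 body from nine facts), kept apart for the 400-line rule.

K2's engine lemmas `X11b.le_padicValRat_of_{nonsplit,split}_divisibility_rankZero` (stepL, `…TwinKatoEngine`) read
Gross–Zagier–Kolyvagin for `rank E(ℚ) = 0` and `Ш` finite. Here both are produced from the ONE-SIDED divisibility they consume:
* `rank E(ℚ) = 0`: `h ∈ char_Λ X(E/ℚ_∞)` with `ι h = ϖ·L` (non-split; `ι(T·h) = ϖ·L` split) has `h(0) ≠ 0`, because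
  `L(0) = 2[0]⁺_f ≠ 0` (non-split, `L(E,1) ≠ 0`) resp. `[T¹]L · log_p κ(γ) = 𝓛_p · [0]⁺_f ≠ 0` (split: Greenberg–Stevens ∕
  Kobayashi and `𝓛_p ≠ 0`); the tree's CONTROL THEOREM `WeierstrassCurve.mordellWeilRank_le_order_of_mem_charIdeal`
  (`rank E(ℚ) ≤ ord_T h`; Greenberg LNM 1716 Lemma 3.1 + the structure theorem = clause 1 of Stein–Wuthrich 6.1, PROVED in the
  tree) then gives `rank E(ℚ) = 0`, so `E(ℚ)` is finite and the §4.2 height is the zero pairing (`RankZeroHeightFree`).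
* `#Ш[p^∞] < ∞`: clause 2 of Stein–Wuthrich 6.1 (`ord_T f_E = rank ↔ Schneider ∧ #Ш[p^∞] < ∞`) at `ord_T f_E = 0 = rank`.
* `Ш` itself may be infinite: then `W.shaOrder = Nat.card Ш = 0` (junk) and `ord_p #Ш = 0`; §1 proves the `p`-primary
  inequality `ord_p #Ш[p^∞] + ord_p ∏c_v − 2 ord_p #E(ℚ)_tors ≤ ord_p(L(E,1)/Ω_E)` regardless and derives the typed shape in
  both cases; §2 packages `Typed.MissingUpperBoundAt` from `rank E(ℚ) = 0` (`#Ш_an = (L(E,1)/Ω_E)·#E(ℚ)²/∏c_v`, `Reg = 1`).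
References (locators only): [cite: SteinWuthrich2013, Thm. 6.1 (p. 20), §4.2] [cite: BalakrishnanMullerStein2015, Thm. 1.7]
[cite: GreenbergLNM1716, Lemma 3.1, §4] [cite: Kobayashi2006DocMath, Cor. 4.2 (p. 575)] [cite: Miller2011LMS, Def. 1.1 and §1]
[cite: MazurTateTeitelbaum1986Invent, §I.14–I.15].
-/

set_option autoImplicit false

noncomputable section

open scoped Classical MatrixGroups ModularForm

open CongruenceSubgroup WeierstrassCurve
  Literature.NumberTheory.EllipticCurves
  Literature.NumberTheory.EllipticCurves.ModularForms
  Literature.NumberTheory.EllipticCurves.Rank1Residual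
  Literature.NumberTheory.EllipticCurves.Rank1Residual.Typed
  Literature.NumberTheory.EllipticCurves.Wuthrich2014
  Literature.NumberTheory.EllipticCurves.SteinWuthrich2013
  Summit.BirchSwinnertonDyer.Rank1Residual
  Summit.BirchSwinnertonDyer.Rank1Residual.RankZeroHeightFree

namespace Summit.BirchSwinnertonDyer.Rank1Residual.X11b

/-! ### §1 Valuation bookkeeping with `Ш` possibly infinite -/

/-- **The `p`-primary bound, no finiteness of `Ш` beyond `Ш[p^∞]`.** From `t · #E(ℚ)_tors² = v · #Ш[p^∞] · ∏ c_v` in `ℚ_p`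
with `t ≠ 0` and `v` of non-negative valuation: `ord_p #Ш[p^∞] + ord_p ∏ c_v − 2 ord_p #E(ℚ)_tors ≤ ord_p t` — the
mathematically meaningful inequality behind `Typed.MissingUpperBoundAt` (whose `W.shaOrder = Nat.card Ш` is `#Ш[p^∞]` up to a
`p`-adic unit when `Ш` is finite and the junk value `0` otherwise). [folklore] -/
theorem padicValNat_card_primary_le_of_torsionSq_mul_eq (W : WeierstrassCurve ℚ) [W.IsElliptic] (p : ℕ)
    [Fact p.Prime] [Finite (AddCommGroup.primaryComponent W.sha p)] {t : ℚ} (ht0 : t ≠ 0) (v : ℚ_[p])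
    (hv : 0 ≤ v.valuation)
    (key : (t : ℚ_[p]) * (W.torsionOrder : ℚ_[p]) ^ 2 =
      v * (Nat.card (AddCommGroup.primaryComponent W.sha p) : ℚ_[p]) * (W.tamagawaProduct : ℚ_[p])) :
    (padicValNat p (Nat.card (AddCommGroup.primaryComponent W.sha p)) : ℤ) + padicValNat p W.tamagawaProduct -
      2 * padicValNat p W.torsionOrder ≤ padicValRat p t := by
  have hpP : p.Prime := Fact.out
  set Shp : ℚ_[p] := (Nat.card (AddCommGroup.primaryComponent W.sha p) : ℚ_[p]) with hShp
  have hShpos : 0 < Nat.card (AddCommGroup.primaryComponent W.sha p) := Nat.card_pos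
  have hShp0 : Shp ≠ 0 := by rw [hShp]; exact_mod_cast hShpos.ne'
  have htQ0 : (t : ℚ_[p]) ≠ 0 := by exact_mod_cast ht0
  have hT0 : (W.torsionOrder : ℚ_[p]) ≠ 0 := by
    exact_mod_cast (W.torsionOrder_pos W.finite_torsion_holds).ne'
  have hc0 : (W.tamagawaProduct : ℚ_[p]) ≠ 0 := by
    exact_mod_cast (W.tamagawaProduct_pos_holds : 0 < W.tamagawaProduct).ne'
  have hv0 : v ≠ 0 := by
    intro h0
    rw [h0, zero_mul, zero_mul] at key
    exact (mul_ne_zero htQ0 (pow_ne_zero 2 hT0)) key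
  have hval := congrArg Padic.valuation key
  rw [Padic.valuation_mul htQ0 (pow_ne_zero 2 hT0), Padic.valuation_pow,
    Padic.valuation_mul (mul_ne_zero hv0 hShp0) hc0, Padic.valuation_mul hv0 hShp0,
    Padic.valuation_ratCast, hShp] at hval
  simp only [Padic.valuation_natCast, Nat.cast_ofNat] at hval
  linarith

/-- Valuation bookkeeping, ONE-SIDED, with only `Ш[p^∞]` finite: from `t · #E(ℚ)_tors² = v · #Ш[p^∞] · ∏ c_v` in `ℚ_p`
with `t ≠ 0` and `v` of non-negative valuation, `ord_p #Ш + ord_p ∏ c_v − 2 ord_p #E(ℚ)_tors ≤ ord_p t`, where `#Ш = W.shaOrder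
= Nat.card Ш` (so `ord_p #Ш = ord_p #Ш[p^∞]` if `Ш` is finite and `ord_p #Ш = ord_p 0 = 0` if not — the bound holds either way).
The `[Finite W.sha]`-free twin of `le_padicValRat_of_torsionSq_mul_eq`. [folklore] -/
theorem le_padicValRat_of_torsionSq_mul_eq_of_finite_primary (W : WeierstrassCurve ℚ) [W.IsElliptic] (p : ℕ)
    [Fact p.Prime] [Finite (AddCommGroup.primaryComponent W.sha p)] {t : ℚ} (ht0 : t ≠ 0) (v : ℚ_[p])
    (hv : 0 ≤ v.valuation)
    (key : (t : ℚ_[p]) * (W.torsionOrder : ℚ_[p]) ^ 2 =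
      v * (Nat.card (AddCommGroup.primaryComponent W.sha p) : ℚ_[p]) * (W.tamagawaProduct : ℚ_[p])) :
    (padicValNat p W.shaOrder : ℤ) + padicValNat p W.tamagawaProduct -
      2 * padicValNat p W.torsionOrder ≤ padicValRat p t := by
  by_cases hfin : Finite W.sha
  · exact le_padicValRat_of_torsionSq_mul_eq W p ht0 v hv key
  · -- `Ш` infinite: `#Ш := Nat.card Ш = 0` (junk), and the `p`-primary bound still controls the other terms
    haveI : Infinite W.sha := not_finite_iff_infinite.mp hfin
    have hsha0 : W.shaOrder = 0 := by
      rw [WeierstrassCurve.shaOrder]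
      exact Nat.card_eq_zero_of_infinite
    rw [hsha0, padicValNat_zero_right, Nat.cast_zero, zero_add]
    have hprim := padicValNat_card_primary_le_of_torsionSq_mul_eq W p ht0 v hv key
    have hShv : (0 : ℤ) ≤ (padicValNat p (Nat.card (AddCommGroup.primaryComponent W.sha p)) : ℤ) := by
      exact_mod_cast Nat.zero_le _
    linarith

/-! ### §2 Packaging `Typed.MissingUpperBoundAt` from `rank E(ℚ) = 0` instead of Gross–Zagier–Kolyvagin -/

/-- **Packaging: the rank-`0` upper-bound shape is `Typed.MissingUpperBoundAt`, given `rank E(ℚ) = 0`.** If `L(E,1) ≠ 0`,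
`rank E(ℚ) = 0` and `L(E,1)/Ω_E` is a rational `q` with `ord_p #Ш + ord_p ∏ c_ℓ − 2 ord_p #E(ℚ)_tors ≤ ord_p q`, then
`ord_p #Ш ≤ ord_p #Ш_an` with `#Ш_an = q · #E(ℚ)² / ∏ c_ℓ` (`r_an = 0` so the leading coefficient is `L(E,1)`; `Reg = 1`
and `E(ℚ) = E(ℚ)_tors` from `rank E(ℚ) = 0` — tree theorems `regulator_eq_one_of_rank_zero`, `finite_point_of_rank_zero`).
The GZK-free twin of `missingUpperBoundAt_of_padicValRat_le_rank_zero`. [cite: Miller2011LMS, Def. 1.1 and §1 (arXiv:1010.2431 p. 3)] -/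
theorem missingUpperBoundAt_of_padicValRat_le_of_mordellWeilRank_eq_zero
    (W : WeierstrassCurve ℚ) [W.IsElliptic] [W.IsGloballyMinimal] (p : ℕ) [Fact p.Prime]
    (hL : W.entireLFunction 1 ≠ 0) (hmw0 : W.mordellWeilRank = 0)
    (hq : ∃ q : ℚ, W.entireLFunction 1 / (W.realPeriodRat : ℂ) = (q : ℂ) ∧
      (padicValNat p W.shaOrder : ℤ) + padicValNat p W.tamagawaProduct -
        2 * padicValNat p W.torsionOrder ≤ padicValRat p q) :
    Typed.MissingUpperBoundAt W p := by
  obtain ⟨q, hqL, hqv⟩ := hq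
  haveI hE : Finite W.toAffine.Point := W.finite_point_of_rank_zero hmw0
  have hr0 : W.analyticRank = 0 := analyticRank_eq_zero_of_entireLFunction_one_ne_zero W hL
  have hΩC : (W.realPeriodRat : ℂ) ≠ 0 := Complex.ofReal_ne_zero.mpr W.realPeriodRat_pos_holds.ne'
  have hsha : shaAn W = ((q * (Nat.card W.toAffine.Point : ℚ) ^ 2 / (W.tamagawaProduct : ℚ) : ℚ) : ℂ) := by
    have hLq : W.entireLFunction 1 = (q : ℂ) * (W.realPeriodRat : ℂ) := by
      rw [← hqL, div_mul_cancel₀ _ hΩC]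
    rw [shaAn_def, W.leadingLCoeff_eq_of_analyticRank_eq_zero hr0, W.regulator_eq_one_of_rank_zero hmw0,
      W.torsionOrder_eq_natCard_of_finite, hLq]
    push_cast
    field_simp
  refine ⟨_, hsha, ?_⟩
  have hq0 : q ≠ 0 := by
    rintro rfl
    apply hL
    rw [← div_mul_cancel₀ (W.entireLFunction 1) hΩC, hqL]
    simp
  have hT : 0 < W.torsionOrder := W.torsionOrder_pos W.finite_torsion_holds
  have hTc : (Nat.card W.toAffine.Point : ℚ) = (W.torsionOrder : ℚ) := by
    rw [W.torsionOrder_eq_natCard_of_finite]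
  have hT0 : (Nat.card W.toAffine.Point : ℚ) ≠ 0 := by rw [hTc]; exact_mod_cast hT.ne'
  have hc0 : (W.tamagawaProduct : ℚ) ≠ 0 := by
    exact_mod_cast (W.tamagawaProduct_pos_holds : 0 < W.tamagawaProduct).ne'
  rw [padicValRat.div (mul_ne_zero hq0 (pow_ne_zero 2 hT0)) hc0,
    padicValRat.mul hq0 (pow_ne_zero 2 hT0), padicValRat.pow, hTc, padicValRat.of_nat,
    padicValRat.of_nat]
  simp only [Nat.cast_ofNat]
  linarith

/-! ### §3 The two leading-term lemmas, with `rank E(ℚ) = 0` and `#Ш[p^∞] < ∞` derived rather than imported -/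

/-- **Rank `0`, NON-SPLIT multiplicative `p ≠ 2`: the upper-bound shape from ONE-SIDED divisibility, no GZK.** As
`le_padicValRat_of_nonsplit_divisibility_rankZero` (Stein–Wuthrich 6.1 at a non-split prime with the zero height datum; the
cofactor's constant term `k(0) ∈ ℤ_p`), except that `rank E(ℚ) = 0` is DERIVED — `h ∈ char_Λ X` with `ι h = ϖ·L`,
`h(0) = ϖ·2[0]⁺_f ≠ 0`, control theorem `mordellWeilRank_le_order_of_mem_charIdeal` — and so is `#Ш[p^∞] < ∞` (clause 2 of
Thm. 6.1 at `ord_T f_E = 0 = rank`); `Ш` itself may be infinite (§1). Also returns `rank E(ℚ) = 0`.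
[cite: SteinWuthrich2013, Thm. 6.1 (p. 20) and §4.2] [cite: BalakrishnanMullerStein2015, Thm. 1.7]
[cite: GreenbergLNM1716, Lemma 3.1 and §4] [cite: Miller2011LMS, §1] -/
theorem le_padicValRat_of_nonsplit_divisibility_rankZero_noGZK (hJ : thm61_nonsplitMultiplicative)
    (W : WeierstrassCurve ℚ) [W.IsElliptic] [W.IsGloballyMinimal] (p : ℕ) [Fact p.Prime]
    {κ : ZpExtension ℚ p} {γ : Field.absoluteGaloisGroup ℚ} {N : ℕ} [NeZero N]
    {f : CuspForm (Gamma0 N) 2} (hp : p ≠ 2) (hL1 : W.entireLFunction 1 ≠ 0)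
    (hmult : W.HasMultiplicativeReductionAtPrime p)
    (hns : ¬ W.HasSplitMultiplicativeReductionAtPrime p)
    {q : ℚ_[p]} (hq0 : q ≠ 0) (hq1 : ‖q‖ < 1) (hqj : tateJ q = (W.j : ℚ_[p]))
    (hκ : κ.IsCyclotomic) (hγ : κ.IsTopGenerator γ) (hγ' : IsCyclotomicVariable p γ)
    (hf : IsNewformOf W f) (D : W.SelmerDualData κ γ) (ϖ : ℚ) (hϖ0 : ϖ ≠ 0)
    (hϖ : (ϖ : ℝ) * W.realPeriodRat = plusPeriod f)
    (L : PowerSeries ℚ_[p]) (hL : IsMultPAdicLFunctionOf f p (-1) L) (hX : D.IsTorsion)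
    (hdiv : ∃ h ∈ D.charIdeal, iwasawaToPowerSeries p h = PowerSeries.C ((ϖ : ℚ) : ℚ_[p]) * L) :
    W.mordellWeilRank = 0 ∧
    ∃ t : ℚ, W.entireLFunction 1 / (W.realPeriodRat : ℂ) = (t : ℂ) ∧
      (padicValNat p W.shaOrder : ℤ) + padicValNat p W.tamagawaProduct -
        2 * padicValNat p W.torsionOrder ≤ padicValRat p t := by
  have hpP : p.Prime := Fact.out
  haveI : Module.Finite (IwasawaAlgebra p) D.X := D.module_finite_holds hγ
  obtain ⟨h, hh, hι⟩ := hdiv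
  -- the control theorem: `rank E(ℚ) ≤ ord_T h`
  have hrk : (W.mordellWeilRank : ℕ∞) ≤ h.order := W.mordellWeilRank_le_order_of_mem_charIdeal hγ D hX hh
  -- a generator of the (principal) characteristic ideal, and the cofactor `k` with `k·g = h`
  obtain ⟨g, hg⟩ := (charIdeal_isPrincipal_holds p D.X).principal
  have hchar : D.charIdeal = Ideal.span {g} := hg
  rw [hchar] at hh
  obtain ⟨k, hkg⟩ := Ideal.mem_span_singleton'.mp hh
  -- the rational `t = ϖ · [0]⁺_f = L(E,1)/Ω_E`
  set s : ℚ := ratPlusSymbol f 0 with hs_def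
  set t : ℚ := ϖ * s with ht_def
  have hΩpos : 0 < W.realPeriodRat := W.realPeriodRat_pos_holds
  have hLval : W.entireLFunction 1 = (((s : ℝ) * plusPeriod f : ℝ) : ℂ) := hf.entireLFunction_one_eq
  have hq : W.entireLFunction 1 / (W.realPeriodRat : ℂ) = ((t : ℚ) : ℂ) := by
    rw [hLval, ← hϖ, div_eq_iff (Complex.ofReal_ne_zero.mpr hΩpos.ne'), ht_def]
    push_cast
    ring
  have hs0 : s ≠ 0 := by
    intro h0
    apply hL1
    rw [hLval, h0]
    simp
  have ht0 : t ≠ 0 := mul_ne_zero hϖ0 hs0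
  -- constant coefficients of `ι(k · g) = ϖ · L`: `k(0) · g(0) = ϖ · 2 [0]⁺_f`
  have hL0 : PowerSeries.constantCoeff L = 2 * (s : ℚ_[p]) := hL.constantCoeff_of_neg_one
  have hkg' : PowerSeries.constantCoeff (k * g) =
      PowerSeries.constantCoeff k * PowerSeries.constantCoeff g := map_mul _ _ _
  have h0 := congrArg PowerSeries.constantCoeff hι
  rw [← hkg, constantCoeff_iwasawaToPowerSeries, hkg', PadicInt.coe_mul, map_mul,
    PowerSeries.constantCoeff_C, hL0] at h0
  -- `h(0) ≠ 0`, hence `ord_T h = 0` and `rank E(ℚ) = 0`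
  have hrhs0 : ((ϖ : ℚ) : ℚ_[p]) * (2 * (s : ℚ_[p])) ≠ 0 := by
    have hϖQ : ((ϖ : ℚ) : ℚ_[p]) ≠ 0 := by exact_mod_cast hϖ0
    have hsQ : ((s : ℚ) : ℚ_[p]) ≠ 0 := by exact_mod_cast hs0
    exact mul_ne_zero hϖQ (mul_ne_zero two_ne_zero hsQ)
  have hg0 : PowerSeries.constantCoeff g ≠ 0 := by
    intro hz
    apply hrhs0
    rw [← h0, hz, PadicInt.coe_zero, mul_zero]
  have hh0 : PowerSeries.constantCoeff h ≠ 0 := by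
    rw [← hkg, hkg']
    intro hz
    apply hrhs0
    rw [← h0]
    have : ((PowerSeries.constantCoeff k * PowerSeries.constantCoeff g : ℤ_[p]) : ℚ_[p]) = 0 := by
      rw [hz, PadicInt.coe_zero]
    rw [← PadicInt.coe_mul, this]
  have hr0 : W.mordellWeilRank = 0 := by
    have hord : h.order ≤ 0 := PowerSeries.order_le 0 (by rwa [PowerSeries.coeff_zero_eq_constantCoeff])
    have h0' : (W.mordellWeilRank : ℕ∞) = 0 := nonpos_iff_eq_zero.mp (hrk.trans hord)
    exact_mod_cast h0'
  haveI : Finite W.toAffine.Point := W.mordellWeilRank_eq_zero_iff_finite.mp hr0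
  -- THE height datum IS the zero pairing in rank `0`; `Reg_p = 1`
  obtain ⟨Dh, hDh⟩ := exists_isMultCanonical_of_finite W p q
  have hReg : padicRegulator Dh = 1 := padicRegulator_eq_one_of_finite W p Dh
  have hSch : SchneiderConjecture Dh := by
    rw [SchneiderConjecture, hReg]
    exact one_ne_zero
  -- Stein–Wuthrich Thm. 6.1: clause 2 gives `#Ш[p^∞] < ∞` at `ord_T f_E = 0 = rank`, then clause 3 in rank `0`
  obtain ⟨-, h2, h3⟩ := hJ W p hp hmult hns q hq0 hq1 hqj κ γ hκ hγ hγ' D hX g hchar Dh hDh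
  have hgord : g.order = (W.mordellWeilRank : ℕ∞) := by
    rw [hr0, Nat.cast_zero]
    exact nonpos_iff_eq_zero.mp (PowerSeries.order_le 0 (by rwa [PowerSeries.coeff_zero_eq_constantCoeff]))
  haveI hfinp : Finite (AddCommGroup.primaryComponent W.sha p) := (h2.mp hgord).2
  obtain ⟨u, hu⟩ := h3 hSch hfinp
  simp only [hr0, pow_zero, mul_one, hReg, PowerSeries.coeff_zero_eq_constantCoeff] at hu
  -- the cofactor's constant term is a `p`-adic INTEGER (not necessarily a unit)
  set k0 : ℚ_[p] := ((PowerSeries.constantCoeff k : ℤ_[p]) : ℚ_[p]) with hk0_def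
  have hk0v : 0 ≤ k0.valuation := PadicInt.valuation_coe_nonneg
  have htcast : ((t : ℚ) : ℚ_[p]) = (ϖ : ℚ_[p]) * (s : ℚ_[p]) := by
    rw [ht_def]; push_cast; ring
  -- the identity `t · #tors² = (u · k0) · #Ш[p^∞] · ∏ c_v`
  have key : (t : ℚ_[p]) * (W.torsionOrder : ℚ_[p]) ^ 2 =
      (((u : ℤ_[p]) : ℚ_[p]) * k0) *
        (Nat.card (AddCommGroup.primaryComponent W.sha p) : ℚ_[p]) * (W.tamagawaProduct : ℚ_[p]) := by
    apply mul_left_cancel₀ (two_ne_zero : (2 : ℚ_[p]) ≠ 0)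
    rw [htcast, hk0_def]
    linear_combination ((PowerSeries.constantCoeff k : ℤ_[p]) : ℚ_[p]) * hu -
      (W.torsionOrder : ℚ_[p]) ^ 2 * h0
  have hv : 0 ≤ (((u : ℤ_[p]) : ℚ_[p]) * k0).valuation := by
    by_cases hk : k0 = 0
    · rw [hk, mul_zero, Padic.valuation_zero]
    · rw [Padic.valuation_mul (coe_units_ne_zero p u) hk, valuation_coe_units_eq_zero, zero_add]
      exact hk0v
  exact ⟨hr0, t, hq, le_padicValRat_of_torsionSq_mul_eq_of_finite_primary W p ht0 _ hv key⟩

/-- **Rank `0`, SPLIT multiplicative `p ≠ 2`: the upper-bound shape from ONE-SIDED divisibility, no GZK.** As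
`le_padicValRat_of_split_divisibility_rankZero` (Stein–Wuthrich 6.1 at a split prime, Greenberg–Stevens, `𝓛_p ≠ 0`), except
that `rank E(ℚ) = 0` is DERIVED — `h ∈ char_Λ X` with `ι(T·h) = ϖ·L`, `h(0) = ϖ·[T¹]L` and `[T¹]L · log_p κ(γ) = 𝓛_p·[0]⁺_f
≠ 0`, control theorem — and so is `#Ш[p^∞] < ∞` (clause 2 of Thm. 6.1); `Ш` may be infinite (§1). Also returns `rank E(ℚ) = 0`.
[cite: SteinWuthrich2013, Thm. 6.1 (p. 20) and §4.2] [cite: Kobayashi2006DocMath, Cor. 4.2 (p. 575)]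
[cite: BalakrishnanMullerStein2015, Thm. 1.7] [cite: MazurTateTeitelbaum1986Invent, §I.14–I.15] -/
theorem le_padicValRat_of_split_divisibility_rankZero_noGZK (hJ : thm61_splitMultiplicative)
    (W : WeierstrassCurve ℚ) [W.IsElliptic] [W.IsGloballyMinimal] (p : ℕ) [Fact p.Prime]
    (hGS : greenberg_stevens (W := W) (p := p)) (h𝓛 : LInvariant_ne_zero (W := W) (p := p))
    {κ : ZpExtension ℚ p} {γ : Field.absoluteGaloisGroup ℚ} {N : ℕ} [NeZero N]
    {f : CuspForm (Gamma0 N) 2} (hp : p ≠ 2) (hL1 : W.entireLFunction 1 ≠ 0)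
    (Dq : TateParameterData W p)
    (hκ : κ.IsCyclotomic) (hγ : κ.IsTopGenerator γ) (hγ' : IsCyclotomicVariable p γ)
    (hf : IsNewformOf W f) (D : W.SelmerDualData κ γ) (ϖ : ℚ) (hϖ0 : ϖ ≠ 0)
    (hϖ : (ϖ : ℝ) * W.realPeriodRat = plusPeriod f)
    (L : PowerSeries ℚ_[p]) (hL : IsSplitMultPAdicLFunctionOf f p L) (hX : D.IsTorsion)
    (hdiv : ∃ h ∈ D.charIdeal,
      iwasawaToPowerSeries p ((PowerSeries.X : IwasawaAlgebra p) * h) = PowerSeries.C ((ϖ : ℚ) : ℚ_[p]) * L) :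
    W.mordellWeilRank = 0 ∧
    ∃ t : ℚ, W.entireLFunction 1 / (W.realPeriodRat : ℂ) = (t : ℂ) ∧
      (padicValNat p W.shaOrder : ℤ) + padicValNat p W.tamagawaProduct -
        2 * padicValNat p W.torsionOrder ≤ padicValRat p t := by
  have hpP : p.Prime := Fact.out
  haveI : Module.Finite (IwasawaAlgebra p) D.X := D.module_finite_holds hγ
  obtain ⟨h, hh, hι⟩ := hdiv
  have hrk : (W.mordellWeilRank : ℕ∞) ≤ h.order := W.mordellWeilRank_le_order_of_mem_charIdeal hγ D hX hh
  obtain ⟨g, hg⟩ := (charIdeal_isPrincipal_holds p D.X).principal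
  have hchar : D.charIdeal = Ideal.span {g} := hg
  rw [hchar] at hh
  obtain ⟨k, hkg⟩ := Ideal.mem_span_singleton'.mp hh
  set s : ℚ := ratPlusSymbol f 0 with hs_def
  set t : ℚ := ϖ * s with ht_def
  have hΩpos : 0 < W.realPeriodRat := W.realPeriodRat_pos_holds
  have hLval : W.entireLFunction 1 = (((s : ℝ) * plusPeriod f : ℝ) : ℂ) := hf.entireLFunction_one_eq
  have hq : W.entireLFunction 1 / (W.realPeriodRat : ℂ) = ((t : ℚ) : ℂ) := by
    rw [hLval, ← hϖ, div_eq_iff (Complex.ofReal_ne_zero.mpr hΩpos.ne'), ht_def]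
    push_cast
    ring
  have hs0 : s ≠ 0 := by
    intro h0
    apply hL1
    rw [hLval, h0]
    simp
  have ht0 : t ≠ 0 := mul_ne_zero hϖ0 hs0
  -- Greenberg–Stevens: `[T¹]L · log = 𝓛 · [0]⁺_f`
  obtain ⟨-, hGS1⟩ := hGS Dq hf hL
  -- `[T¹] ι(T·k·g) = k(0)·g(0)`
  have hkg' : PowerSeries.constantCoeff (k * g) =
      PowerSeries.constantCoeff k * PowerSeries.constantCoeff g := map_mul _ _ _
  have h1 : ((PowerSeries.constantCoeff k : ℤ_[p]) : ℚ_[p]) *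
      ((PowerSeries.constantCoeff g : ℤ_[p]) : ℚ_[p]) =
        ((ϖ : ℚ) : ℚ_[p]) * PowerSeries.coeff 1 L := by
    have h := congrArg (PowerSeries.coeff 1) hι
    rw [← hkg] at h
    rw [iwasawaToPowerSeries, PowerSeries.coeff_map, PowerSeries.coeff_succ_X_mul,
      PowerSeries.coeff_zero_eq_constantCoeff, hkg', PowerSeries.coeff_C_mul, map_mul] at h
    exact h
  have h𝓛0 : LInvariant Dq ≠ 0 := h𝓛 Dq
  -- `h(0) ≠ 0`: `k(0)·g(0)·log κ(γ) = ϖ·𝓛·[0]⁺_f ≠ 0`; hence `rank E(ℚ) = 0`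
  have hprod : ((PowerSeries.constantCoeff k : ℤ_[p]) : ℚ_[p]) * ((PowerSeries.constantCoeff g : ℤ_[p]) : ℚ_[p]) *
      padicLog p (cyclotomicGenerator p) = ((ϖ : ℚ) : ℚ_[p]) * (LInvariant Dq * (s : ℚ_[p])) := by
    rw [h1, mul_assoc, hGS1]
  have hrhs0 : ((ϖ : ℚ) : ℚ_[p]) * (LInvariant Dq * (s : ℚ_[p])) ≠ 0 := by
    have hϖQ : ((ϖ : ℚ) : ℚ_[p]) ≠ 0 := by exact_mod_cast hϖ0
    have hsQ : ((s : ℚ) : ℚ_[p]) ≠ 0 := by exact_mod_cast hs0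
    exact mul_ne_zero hϖQ (mul_ne_zero h𝓛0 hsQ)
  have hkg0 : ((PowerSeries.constantCoeff k : ℤ_[p]) : ℚ_[p]) * ((PowerSeries.constantCoeff g : ℤ_[p]) : ℚ_[p]) ≠ 0 := by
    intro hz
    apply hrhs0
    rw [← hprod, hz, zero_mul]
  have hg0 : PowerSeries.constantCoeff g ≠ 0 := by
    intro hz
    apply hkg0
    rw [hz, PadicInt.coe_zero, mul_zero]
  have hh0 : PowerSeries.constantCoeff h ≠ 0 := by
    rw [← hkg, hkg']
    intro hz
    apply hkg0
    rw [← PadicInt.coe_mul, hz, PadicInt.coe_zero]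
  have hr0 : W.mordellWeilRank = 0 := by
    have hord : h.order ≤ 0 := PowerSeries.order_le 0 (by rwa [PowerSeries.coeff_zero_eq_constantCoeff])
    have h0' : (W.mordellWeilRank : ℕ∞) = 0 := nonpos_iff_eq_zero.mp (hrk.trans hord)
    exact_mod_cast h0'
  haveI : Finite W.toAffine.Point := W.mordellWeilRank_eq_zero_iff_finite.mp hr0
  -- THE height datum at the split prime IS the zero pairing in rank `0`; `Reg_p = 1`
  obtain ⟨Dh, hDh⟩ := exists_isSplitMultCanonical_of_finite W p Dq
  have hReg : padicRegulator Dh = 1 := padicRegulator_eq_one_of_finite W p Dh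
  have hSch : SchneiderConjecture Dh := by
    rw [SchneiderConjecture, hReg]
    exact one_ne_zero
  -- Stein–Wuthrich Thm. 6.1 (split): clause 2 gives `#Ш[p^∞] < ∞`, then clause 3 in rank `0`
  obtain ⟨-, h2, h3⟩ := hJ W p hp Dq κ γ hκ hγ hγ' D hX g hchar Dh hDh
  have hgord : g.order = (W.mordellWeilRank : ℕ∞) := by
    rw [hr0, Nat.cast_zero]
    exact nonpos_iff_eq_zero.mp (PowerSeries.order_le 0 (by rwa [PowerSeries.coeff_zero_eq_constantCoeff]))
  haveI hfinp : Finite (AddCommGroup.primaryComponent W.sha p) := (h2.mp hgord).2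
  obtain ⟨u, hu⟩ := h3 hSch hfinp
  simp only [hr0, zero_add, pow_one, hReg, mul_one, PowerSeries.coeff_zero_eq_constantCoeff] at hu
  set k0 : ℚ_[p] := ((PowerSeries.constantCoeff k : ℤ_[p]) : ℚ_[p]) with hk0_def
  have hk0v : 0 ≤ k0.valuation := PadicInt.valuation_coe_nonneg
  have htcast : ((t : ℚ) : ℚ_[p]) = (ϖ : ℚ_[p]) * (s : ℚ_[p]) := by
    rw [ht_def]; push_cast; ring
  -- the identity `t · #tors² = (u · k0) · #Ш[p^∞] · ∏ c_v`
  have key : (t : ℚ_[p]) * (W.torsionOrder : ℚ_[p]) ^ 2 =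
      (((u : ℤ_[p]) : ℚ_[p]) * k0) *
        (Nat.card (AddCommGroup.primaryComponent W.sha p) : ℚ_[p]) * (W.tamagawaProduct : ℚ_[p]) := by
    apply mul_left_cancel₀ h𝓛0
    rw [htcast, hk0_def]
    linear_combination (-(((ϖ : ℚ) : ℚ_[p]) * (W.torsionOrder : ℚ_[p]) ^ 2)) * hGS1 -
      (padicLog p (cyclotomicGenerator p) * (W.torsionOrder : ℚ_[p]) ^ 2) * h1 +
      ((PowerSeries.constantCoeff k : ℤ_[p]) : ℚ_[p]) * hu
  have hv : 0 ≤ (((u : ℤ_[p]) : ℚ_[p]) * k0).valuation := by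
    by_cases hk : k0 = 0
    · rw [hk, mul_zero, Padic.valuation_zero]
    · rw [Padic.valuation_mul (coe_units_ne_zero p u) hk, valuation_coe_units_eq_zero, zero_add]
      exact hk0v
  exact ⟨hr0, t, hq, le_padicValRat_of_torsionSq_mul_eq_of_finite_primary W p ht0 _ hv key⟩

end Summit.BirchSwinnertonDyer.Rank1Residual.X11b

end
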